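import Summits.Ventures.HodgeRepro2.T6InterfaceOfData
import Summits.Ventures.HodgeRepro2.T6A3IntegralModel
import Summits.Ventures.HodgeRepro2.T6A1Complex

/-!
# T6InterfaceToyN — a transfer shadow on which the displayed hypothesis (N) is TRUE

README §10.5(ii)(d) for the hypothesis set of M1 (`theoremA_of_N`, TARGET-T6.md §5): the one displayed
hypothesis `Hyp.PeriodN D` is SATISFIABLE — for every face setting `F`, every embedding `σ : K →+* ℂ` and
every non-zero `w` on the `σ`-eigenline of `K ⊗ ℂ`, some `D : TransferShadow F` has `Hyp.PeriodN D`
(`exists_periodN`). The witness `toyN F hw0` is the even toy of `T6InterfaceToy` (`Alg k := H^{2k}`,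
`∫_B := topCoeff` in the monomial basis of `Toy.b1 K`, `⋆ := Toy.pont`) assembled through
`TransferShadow.ofData` with a NON-TRIVIAL surface side: `HS := H^*(B, ℂ)`, `f^* := id`, the Gysin class
`z := e_{sᶜ}` — the rational monomial of degree `20` chosen by LEFT PERFECTNESS of the top-degree pairing
(`exists_topCoeff_basis_compl_mul_ne_zero`) against the eigen-monomial `e_0 ∧ e_1 ∧ e_2 ∧ e_3`,
`e_i := single i w` (non-zero by `Pi.linearIndependent_single_of_ne_zero` +
`exteriorPower.ιMulti_family_linearIndependent_field`) — and `∫_S := ∫_B^ℂ (extC z ∪ ·)`, so that the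
projection formula `z_proj` is `topCoeff_extC` (the complex monomial basis `bC` is the base change of
`Toy.b1 K`, `h1ToC_b1` / `extC_basis`) and (N) holds by the choice of `s` (`sN_spec`). Degree `20` of `z`
is forced: the pairing of `e_{sᶜ}` with a degree-`4` class is non-zero only in total degree `24`
(`card_sN_compl`). `K : Type` (the interface's `HS : Type`). The eigenvector input `(w, hw, hw0)` exists
for every `K` (`exists_eigenvector_KC`: t6-p1's `A1Complex.iSup_eigenLineK_eq_top` by name + Mathlib's
`Algebra.TensorProduct.nontrivial_of_algebraMap_injective_of_isDomain`), whence the UNCONDITIONAL form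
`exists_periodN_of_face (F : FaceSetting K) : ∃ D : TransferShadow F, Hyp.PeriodN D` — §10.5(ii)(d) for
the M1 hypothesis set, for every face setting. Rebuilt by t6-lead g2 from the l. 4563 / l. 4644 shape
(the g0 sources were not in HOME).
§8(d): uses an L-value-free non-vanishing device: NO.
-/

namespace Summit.Ventures.HodgeRepro2.T6.ToyN

open ExteriorAlgebra ExteriorDuality GradedTensorProduct Parity
open scoped TensorProduct

/-! ## 1. Left perfectness of the top-degree pairing (carrier-free, mirrors `T6ExteriorDuality`) -/

section LeftPerfect

variable {F : Type*} [Field F] {M : Type*} [AddCommGroup M] [Module F M]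
variable {I : Type*} [Fintype I] [LinearOrder I] (b : Module.Basis I F M)

/-- `topCoeff (e_{sᶜ} * e_t) = 0` unless `t = s`. -/
lemma topCoeff_basis_compl_mul_basis_of_ne {s t : Finset I} (hts : t ≠ s) :
    topCoeff b (b.ExteriorAlgebra sᶜ * b.ExteriorAlgebra t) = 0 := by
  classical
  by_cases h : Disjoint sᶜ t
  · rw [basis_mul_basis_of_disjoint b h, Units.smul_def, map_zsmul, topCoeff_basis]
    have hsub : t ⊆ s := fun i hi => by
      by_contra hi'
      exact Finset.disjoint_left.mp h (Finset.mem_compl.mpr hi') hi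
    have hne : sᶜ.disjUnion t h ≠ Finset.univ := by
      intro huniv
      apply hts
      refine le_antisymm hsub ?_
      intro i hi
      have := Finset.mem_univ i
      rw [← huniv, Finset.mem_disjUnion] at this
      rcases this with h1 | h1
      · exact absurd hi (Finset.mem_compl.mp h1)
      · exact h1
    rw [if_neg hne, smul_zero]
  · rw [basis_mul_basis_of_not_disjoint b h, map_zero]

/-- `topCoeff (e_{sᶜ} * e_s) = ±1 ≠ 0`. -/
lemma topCoeff_basis_compl_mul_basis_ne_zero (s : Finset I) :
    topCoeff b (b.ExteriorAlgebra sᶜ * b.ExteriorAlgebra s) ≠ 0 := by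
  classical
  have h : Disjoint sᶜ s := disjoint_compl_left
  rw [basis_mul_basis_of_disjoint b h, Units.smul_def, map_zsmul, topCoeff_basis]
  have : sᶜ.disjUnion s h = Finset.univ := by
    ext i; simpa [or_comm] using em (i ∈ s)
  rw [if_pos this]
  exact units_zsmul_one_ne_zero _

/-- LEFT PERFECTNESS: every non-zero `p` pairs non-trivially with some monomial `e_{sᶜ}` on the left. -/
theorem exists_topCoeff_basis_compl_mul_ne_zero (p : ExteriorAlgebra F M) (hp : p ≠ 0) :
    ∃ s : Finset I, topCoeff b (b.ExteriorAlgebra sᶜ * p) ≠ 0 := by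
  classical
  set B := b.ExteriorAlgebra with hB
  have hrepr : B.repr p ≠ 0 := fun h => hp ((LinearEquiv.map_eq_zero_iff B.repr).mp h)
  obtain ⟨s, hs⟩ : ∃ s, B.repr p s ≠ 0 := by
    by_contra! h
    exact hrepr (Finsupp.ext h)
  refine ⟨s, ?_⟩
  have hexp : p = ∑ t : Finset I, B.repr p t • B t := (B.sum_repr p).symm
  rw [hexp, Finset.mul_sum, map_sum, Finset.sum_eq_single s]
  · rw [mul_smul_comm, LinearMap.map_smul, smul_eq_mul]
    exact mul_ne_zero hs (topCoeff_basis_compl_mul_basis_ne_zero b s)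
  · intro t _ hts
    rw [mul_smul_comm, LinearMap.map_smul, topCoeff_basis_compl_mul_basis_of_ne b hts, smul_zero]
  · intro h; exact absurd (Finset.mem_univ s) h

end LeftPerfect

/-! ## 2. The complex monomial basis: the base change of `Toy.b1 K` -/

variable (K : Type) [Field K] [NumberField K]

/-- The ℂ-basis of `H¹(B, ℂ) = Fin 4 → ℂ ⊗[ℚ] K` obtained from the ℚ-basis `Toy.b1 K` of `H¹(B, ℚ)` by
base change (`ℂ ⊗[ℚ] (Fin 4 → K) ≃ Fin 4 → ℂ ⊗[ℚ] K`). -/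
noncomputable def bC : Module.Basis (Fin (Module.finrank ℚ (H1 K))) ℂ (H1C K) :=
  (Algebra.TensorProduct.basis ℂ (Toy.b1 K)).map (TensorProduct.piRight ℚ ℂ ℂ fun _ : Fin 4 => K)

/-- `h1ToC` sends the rational basis to the complex one: `h1ToC (b1 i) = bC i`. -/
lemma h1ToC_b1 (i : Fin (Module.finrank ℚ (H1 K))) : h1ToC K (Toy.b1 K i) = bC K i := by
  simp only [bC, Module.Basis.map_apply, Algebra.TensorProduct.basis_apply,
    TensorProduct.piRight_apply, TensorProduct.piRightHom_tmul]
  ext j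
  simp [h1ToC]

/-- `extC` sends the rational monomial basis to the complex monomial basis: `extC e_s = e_s`. -/
lemma extC_basis (s : Finset (Fin (Module.finrank ℚ (H1 K)))) :
    extC K ((Toy.b1 K).ExteriorAlgebra s) = (bC K).ExteriorAlgebra s := by
  rw [ExteriorAlgebra.basis_apply, ExteriorAlgebra.basis_apply]
  show extC K (ιMulti ℚ _ _) = ιMulti ℂ _ _
  rw [A3IntegralModel.extC_ιMulti]
  congr 1
  funext i
  simp [h1ToC_b1]

/-- The complex top coefficient of a rational class is its rational top coefficient:
`topCoeff bC (extC y) = topCoeff b1 y`. -/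
lemma topCoeff_extC (y : HB K) :
    topCoeff (bC K) (extC K y) = ((topCoeff (Toy.b1 K) y : ℚ) : ℂ) := by
  have h : (topCoeff (bC K)).restrictScalars ℚ ∘ₗ (extC K).toLinearMap =
      Algebra.linearMap ℚ ℂ ∘ₗ topCoeff (Toy.b1 K) := by
    refine (Toy.b1 K).ExteriorAlgebra.ext fun s => ?_
    simp only [LinearMap.comp_apply, LinearMap.restrictScalars_apply, AlgHom.toLinearMap_apply,
      Algebra.linearMap_apply, extC_basis, topCoeff_basis]
    split_ifs <;> simp
  have := LinearMap.congr_fun h y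
  simp only [LinearMap.comp_apply, LinearMap.restrictScalars_apply, AlgHom.toLinearMap_apply,
    Algebra.linearMap_apply] at this
  rw [this, eq_ratCast]

/-! ## 3. The eigen-monomial `e_0 ∧ e_1 ∧ e_2 ∧ e_3`, `e_i := single i w` -/

variable {K}

/-- `e_i := single i w`: the eigenvector `w` placed at the vertex `i`. -/
noncomputable def eVec (w : KC K) (i : Fin 4) : H1C K := Pi.single i w

/-- `e_i ∈ ℓ_{i,σ}` for `w` on the `σ`-eigenline. -/
lemma eVec_mem {σ : K →+* ℂ} {w : KC K} (hw : w ∈ eigenLineK K σ) (i : Fin 4) :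
    eVec w i ∈ eigenLine K i σ :=
  Submodule.mem_map_of_mem hw

/-- The eigen-monomial `e_0 ∧ e_1 ∧ e_2 ∧ e_3 ∈ H^4(B, ℂ)`. -/
noncomputable def eigenMon (w : KC K) : HBC K :=
  ι ℂ (eVec w 0) * ι ℂ (eVec w 1) * ι ℂ (eVec w 2) * ι ℂ (eVec w 3)

/-- The eigen-monomial is `ιMulti ℂ 4` of the family `e`. -/
lemma eigenMon_eq_ιMulti (w : KC K) : eigenMon w = ιMulti ℂ 4 (eVec w) := by
  simp only [eigenMon, ιMulti_succ_apply, ιMulti_zero_apply, mul_one, mul_assoc]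
  rfl

/-- The eigen-monomial is homogeneous of degree `4`. -/
lemma eigenMon_mem (w : KC K) : eigenMon w ∈ ⋀[ℂ]^4 (H1C K) := by
  rw [eigenMon_eq_ιMulti]
  exact ιMulti_range ℂ 4 ⟨_, rfl⟩

/-- `e_0 ∧ e_1 ∧ e_2 ∧ e_3 ≠ 0` for `w ≠ 0`: the `e_i` are linearly independent, so their wedge is a
member of a linearly independent family. -/
lemma eigenMon_ne_zero {w : KC K} (hw0 : w ≠ 0) : eigenMon w ≠ 0 := by
  rw [eigenMon_eq_ιMulti]
  have hli : LinearIndependent ℂ (fun i : Fin 4 => (Pi.single i w : H1C K)) :=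
    Pi.linearIndependent_single_of_ne_zero fun _ => hw0
  have hfam := exteriorPower.ιMulti_family_linearIndependent_field (n := 4) (v := eVec w) hli
  have hcard : (Finset.univ : Finset (Fin 4)).card = 4 := by simp
  have hne := hfam.ne_zero (Set.powersetCard.ofCard hcard)
  have hemb : ∀ i, (Set.powersetCard.ofFinEmbEquiv.symm (Set.powersetCard.ofCard hcard)) i = i := by
    intro i
    rw [Set.powersetCard.ofFinEmbEquiv_symm_apply]
    exact (congrFun (Finset.orderEmbOfFin_unique hcard (f := id) (fun _ => Finset.mem_univ _)
      strictMono_id) i).symm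
  intro h0
  apply hne
  apply Subtype.ext
  simp only [exteriorPower.ιMulti_family_apply_coe, ExteriorAlgebra.ιMulti_family,
    Submodule.coe_zero]
  convert h0 using 2
  funext i
  simp [hemb]

/-! ## 4. The Gysin class, `∫_S`, and the N-shadow -/

variable (F : FaceSetting K) {w : KC K} (hw0 : w ≠ 0)

/-- The index set `s` of the Gysin monomial: `topCoeff (e_{sᶜ} * (e_0 ∧ e_1 ∧ e_2 ∧ e_3)) ≠ 0`
(left perfectness). -/
noncomputable def sN : Finset (Fin (Module.finrank ℚ (H1 K))) :=
  Classical.choose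
    (exists_topCoeff_basis_compl_mul_ne_zero (bC K) (eigenMon w) (eigenMon_ne_zero hw0))

/-- The defining property of `sN`. -/
lemma sN_spec : topCoeff (bC K) ((bC K).ExteriorAlgebra (sN hw0)ᶜ * eigenMon w) ≠ 0 :=
  Classical.choose_spec
    (exists_topCoeff_basis_compl_mul_ne_zero (bC K) (eigenMon w) (eigenMon_ne_zero hw0))

/-- The Gysin class `z := e_{sᶜ}`, a rational monomial. -/
noncomputable def zN : HB K := (Toy.b1 K).ExteriorAlgebra (sN hw0)ᶜ

/-- `extC z = e_{sᶜ}` in the complex monomial basis. -/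
lemma extC_zN : extC K (zN hw0) = (bC K).ExteriorAlgebra (sN hw0)ᶜ := extC_basis K _

include F in
/-- `sᶜ` has `20` elements: the pairing of `e_{sᶜ}` with a class of degree `4` is non-zero only in total
degree `24 = dim H¹(B)`. -/
lemma card_sN_compl : (sN hw0)ᶜ.card = 20 := by
  by_contra hne
  apply sN_spec hw0
  refine topCoeff_mul_of_ne (bC K) ?_ (basis_mem (bC K) _) (eigenMon_mem w)
  rw [Toy.card_index F]
  omega

include F in
/-- `z ∈ H^{20}(B, ℚ)`. -/
lemma zN_mem : zN hw0 ∈ degB K 20 := by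
  have := basis_mem (Toy.b1 K) (sN hw0)ᶜ
  rwa [card_sN_compl F hw0] at this

/-- `∫_S := ∫_B^ℂ (extC z ∪ ·)` on `HS := H^*(B, ℂ)`. -/
noncomputable def intSN : HBC K →ₗ[ℂ] ℂ :=
  topCoeff (bC K) ∘ₗ LinearMap.mulLeft ℂ (extC K (zN hw0))

/-- `∫_S u = topCoeff (extC z * u)`. -/
lemma intSN_apply (u : HBC K) : intSN hw0 u = topCoeff (bC K) (extC K (zN hw0) * u) := rfl

/-- THE N-DATA: the toy's even data (`Alg k := H^{2k}`, `∫_B := topCoeff`, `⋆ := Toy.pont`) with the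
surface side `HS := H^*(B, ℂ)`, `f^* := id`, `z := e_{sᶜ}`, `∫_S := ∫_B^ℂ (extC z ∪ ·)`. -/
noncomputable def toyNData : OfData.ShadowData F where
  Alg k := degB K (2 * k)
  alg_deg _ := le_rfl
  alg_one := one_mem_zero
  alg_mul := fun {k l a b} ha hb => by
    have := mul_mem_exteriorPower ha hb
    rwa [show 2 * k + 2 * l = 2 * (k + l) by ring] at this
  alg_pull := fun x {k} {a} ha =>
    map_mem_exteriorPower_of_ι (pullEndo K x)
      (fun v => by rw [pullEndo, ExteriorAlgebra.lift_ι_apply]; exact ι_mem_one _) ha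
  alg_lefschetz := fun _ ha _ => ha
  intB := Toy.intB K
  intB_deg := Toy.intB_deg F
  intB_ne_zero := Toy.intB_ne_zero F
  alg_pont_even := fun {k l a b} ha hb =>
    ⟨Toy.pont K a b, Toy.pont_mem F ha hb, fun _ u _ => Toy.pont_spec a b u⟩
  HS := HBC K
  pull := AlgHom.id ℂ (HBC K)
  intS := intSN hw0
  z := zN hw0
  z_deg := zN_mem F hw0
  z_alg := zN_mem F hw0
  z_proj := fun u => by
    rw [AlgHom.id_apply, intSN_apply, ← map_mul, topCoeff_extC]
    rfl

/-- THE N-SHADOW: `TransferShadow.ofData` of the N-data. -/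
noncomputable def toyN : TransferShadow F := TransferShadow.ofData (toyNData F hw0)

/-- On `toyN`, the displayed (N) holds at `σ` with the generators `e_i = single i w`:
`∫_S f^*(e_0 ∧ e_1 ∧ e_2 ∧ e_3) = topCoeff (e_{sᶜ} * (e_0 ∧ e_1 ∧ e_2 ∧ e_3)) ≠ 0`. -/
theorem periodN_toyN {σ : K →+* ℂ} (hw : w ∈ eigenLineK K σ) : Hyp.PeriodN (toyN F hw0) := by
  refine ⟨σ, eVec w, eVec_mem hw, ?_⟩
  show intSN hw0 ((AlgHom.id ℂ (HBC K)) (eigenMon w)) ≠ 0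
  rw [AlgHom.id_apply, intSN_apply, extC_zN]
  exact sN_spec hw0

/-- NON-VACUITY OF THE HYPOTHESIS SET OF M1 (README §10.5(ii)(d)): for every face setting `F`, every
embedding `σ` and every non-zero `w` on the `σ`-eigenline of `K ⊗ ℂ`, some transfer shadow satisfies the
displayed hypothesis (N). -/
theorem exists_periodN (F : FaceSetting K) (σ : K →+* ℂ) {w : KC K} (hw : w ∈ eigenLineK K σ)
    (hw0 : w ≠ 0) : ∃ D : TransferShadow F, Hyp.PeriodN D :=
  ⟨toyN F hw0, periodN_toyN F hw0 hw⟩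

/-! ## 5. The unconditional form: every `K` has an eigenvector, every face has an N-shadow -/

variable (K)

/-- `K ⊗ ℂ ≠ 0` (Mathlib: the tensor product of two domains over a field is non-trivial). -/
lemma nontrivial_KC : Nontrivial (KC K) :=
  Algebra.TensorProduct.nontrivial_of_algebraMap_injective_of_isDomain ℚ ℂ K
    (algebraMap ℚ ℂ).injective (algebraMap ℚ K).injective

/-- Some eigenline of `K ⊗ ℂ` carries a non-zero vector: the eigenlines span `K ⊗ ℂ`
(t6-p1's `A1Complex.iSup_eigenLineK_eq_top`) and `K ⊗ ℂ ≠ 0`. -/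
theorem exists_eigenvector_KC : ∃ (σ : K →+* ℂ) (w : KC K), w ∈ eigenLineK K σ ∧ w ≠ 0 := by
  haveI := nontrivial_KC K
  by_contra h
  have hbot : ∀ σ : K →+* ℂ, eigenLineK K σ = ⊥ := fun σ => by
    rw [Submodule.eq_bot_iff]
    intro w hw
    by_contra hw0
    exact h ⟨σ, w, hw, hw0⟩
  have htop := A1Complex.iSup_eigenLineK_eq_top K
  rw [iSup_eq_bot.mpr hbot] at htop
  exact bot_ne_top htop

/-- NON-VACUITY OF THE HYPOTHESIS SET OF M1, UNCONDITIONAL IN THE FACE (README §10.5(ii)(d)): for every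
face setting `F`, some transfer shadow satisfies the displayed hypothesis (N). -/
theorem exists_periodN_of_face (F : FaceSetting K) : ∃ D : TransferShadow F, Hyp.PeriodN D := by
  obtain ⟨σ, w, hw, hw0⟩ := exists_eigenvector_KC K
  exact exists_periodN F σ hw hw0

end Summit.Ventures.HodgeRepro2.T6.ToyN
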